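import Literature.NumberTheory.LFunctions.RHWave0
import Literature.NumberTheory.LFunctions.ZetaZeros
import HarnessLib

/-!
# Gaps below `0.37` of the mean spacing between low-lying zeros of Dirichlet `L`-functions on GRH
# (Conrey–Iwaniec–Soundararajan 2012, Theorem 2.1 — the degree-one case)

Topic `Literature/NumberTheory/LFunctions` (namespace `Literature.NumberTheory.LFunctions`; the
paper's defining equation for `μ_d` lives in the sub-namespace `ConreyIwaniecSoundararajan2012`).
STATEMENT LAYER for the LANDAU–SIEGEL programme, sub-cell §C (harvest row r2-T14; lens complete +
nearmiss; tag E*-ℓ): the ONLY printed theorem producing a pair of zeros of a genuine `L`-function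
closer than HALF the mean spacing — in a FAMILY, on GRH, via the asymptotic large sieve. ONE named
fact (D-0014, `def … : Prop`, nothing asserted) — Theorem 2.1 in its degree-`d = 1` case (twists of
`L_f = ζ`, i.e. the Dirichlet `L`-functions themselves) — plus PROVED bookkeeping on the defining
equation of `μ_d`.

## What the source prints (held text `paper:arxiv-1202.2671` = Acta Arith. 155 (2012) 353–371,
read 2026-08-26)

§2 (chunk p0004:L1–24): "Let `L_f(s)` be a primitive automorphic `L`-function of degree `d` and
level `N`, and let `L_f(s,χ)` be its twist by a primitive Dirichlet character `χ`. …
**Theorem 2.1.** Assume the Riemann Hypothesis for `L_f(s,χ)` for all primitive `χ` of modulus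
coprime to `N`. Define `μ_d` with `0 < μ_d < 1` to be the unique positive real solution `μ` of
`μ + 2∫₀^{μ/d} (sin πv/πv)² dv = 1`. Then, for any `ε > 0` and for all sufficiently large `Q`,
there is a `q` with `(q,N) = 1` and `Q ≤ q ≤ 2Q` and a primitive `χ mod q` and a pair of zeros
`1/2 + iγ` and `1/2 + iγ′` of `L_f(s,χ)` such that `|γ|, |γ′| ≤ 1` and
`|γ − γ′| < (μ_d + ε) · 2π/(d log Q)`. The first few values for `μ_d` are approximately
`μ₁ = 0.366`, `μ₂ = 0.519`, `μ₃ = 0.611`, `μ₄ = 0.674`, and `μ₅ = 0.719`. … Since `2π/(d log Q)`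
is the average spacing between consecutive zeros at low heights, our theorem may be rephrased to
say that there are a pair of zeros that are closer together than `μ_d` times the average spacing."
§1 (p0003:L22–42), WHY THIS SAYS NOTHING ABOUT CLASS NUMBERS (kept in the harvest row r2-OQ10):
GRH is used (i) for the zeros in the window being on the line and (ii) for square-root
cancellation in `Σ_{n ≤ x} μ(n)χ(n)`, `|t| ≪ x`, "in particular, GRH holds on the real axis, too …
this assumption already rules out the existence of Landau-Siegel zeros … The upshot is that we
cannot conclude anything about class numbers from our theorem."

## Lean rendering / design choices

* DEGREE ONE ONLY. For `d = 1` the primitive automorphic `L`-function of level `N = 1` is `ζ`, its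
  twists by primitive `χ` are the Dirichlet `L`-functions `L(s,χ)` (Mathlib
  `DirichletCharacter.LFunction`), the coprimality condition `(q, 1) = 1` is void, and the mean
  spacing is `2π/log Q`. The general-`d` statement needs automorphic `L`-functions and is left as
  `-- TODO(general form)` (the tree's `AutomorphicGRH.lean` vocabulary would be the starting point).
* THE HYPOTHESIS is the tree's `GeneralizedRiemannHypothesis` (`RHWave0.lean`: every zero of every
  `L(s,χ)` in the open strip lies on `Re s = ½`, all moduli — equivalent to the primitive-only form
  by the tree's `generalizedRiemannHypothesis_iff_isPrimitive`; it contains RH for `ζ = L(s, 1)`,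
  which the printed hypothesis "for all primitive `χ`" also contains). Taken as an explicit
  antecedent; nothing asserts it.
* `μ_d`: rather than a `def` of "the unique root", the fact quantifies over EVERY `μ ∈ (0,1)`
  solving the printed equation (`IsGapConstant 1 μ`); by the printed uniqueness this is the same
  statement, and it avoids a choice function. The numerical value `μ₁ ≈ 0.366` is NOT typed (a
  printed approximation, not a theorem); `sin πv/(πv)` is the tree's `sineKernel` (`ZetaZeros.lean`).
* "a pair of zeros `½ + iγ`, `½ + iγ′`": two zeros counted with multiplicity — rendered as
  ordinates `γ, γ′` with `|γ|, |γ′| ≤ 1`, both zeros of `L(·,χ)` on the critical line, and EITHER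
  `γ ≠ γ′` OR `½ + iγ` a multiple zero (`deriv (L χ) (½ + iγ) = 0`); this is implied by either
  reading of "pair", so the typed fact is at most WEAKER than print.
* "for all sufficiently large `Q`": `∃ Q₀, ∀ Q ≥ Q₀` over real `Q`, with `q : ℕ`, `Q ≤ q ≤ 2Q`.
* The large-gap sentence ("By a similar method we could show … `λ_d − ε`") is not a stated theorem
  and is not typed.

WHAT THIS IS NOT: no claim about zeros of any `L`-function, about GRH, or about class numbers /
Siegel zeros (the authors themselves explain the theorem is void there); not the asymptotic large
sieve itself (`AsymptoticLargeSieve*.lean`, typer-1's files).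

## References

* [ConreyIwaniecSoundararajan2012SmallGaps] J. B. Conrey, H. Iwaniec, K. Soundararajan, *Small gaps
  between zeros of twisted L-functions*, Acta Arith. 155 (2012) 353–371 = arXiv:1202.2671, §2
  Theorem 2.1 (p. 3 of the preprint), §1.
* Tree: `GeneralizedRiemannHypothesis` (RHWave0.lean), `sineKernel` (ZetaZeros.lean).
-/

noncomputable section

open Real Complex

namespace Literature.NumberTheory.LFunctions

namespace ConreyIwaniecSoundararajan2012

/-- **The defining equation of `μ_d`**: `0 < μ < 1` and `μ + 2∫₀^{μ/d} (sin πv/(πv))² dv = 1`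
("the unique positive real solution"; `μ₁ ≈ 0.366`, `μ₂ ≈ 0.519`, … as printed, not typed).
[cite: ConreyIwaniecSoundararajan2012SmallGaps, Theorem 2.1 (definition of μ_d)] -/
def IsGapConstant (d μ : ℝ) : Prop :=
  0 < μ ∧ μ < 1 ∧ μ + 2 * ∫ v in (0 : ℝ)..(μ / d), sineKernel v ^ 2 = 1

/-- The left side `μ + 2∫₀^{μ/d} (sin πv/(πv))² dv` of the defining equation, as a function of `μ`.
[cite: ConreyIwaniecSoundararajan2012SmallGaps, Theorem 2.1 (definition of μ_d)] -/
def gapFunction (d μ : ℝ) : ℝ :=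
  μ + 2 * ∫ v in (0 : ℝ)..(μ / d), sineKernel v ^ 2

/-- `IsGapConstant d μ` unfolds to `0 < μ < 1 ∧ gapFunction d μ = 1`.
[cite: ConreyIwaniecSoundararajan2012SmallGaps, Theorem 2.1 (definition of μ_d)] -/
theorem isGapConstant_iff (d μ : ℝ) :
    IsGapConstant d μ ↔ 0 < μ ∧ μ < 1 ∧ gapFunction d μ = 1 :=
  Iff.rfl

/-- At `μ = 0` the left side vanishes (so `0` is not a solution: the root is positive, as printed).
[cite: ConreyIwaniecSoundararajan2012SmallGaps, Theorem 2.1 (definition of μ_d)] -/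
theorem gapFunction_zero (d : ℝ) : gapFunction d 0 = 0 := by
  simp [gapFunction]

/-- The integrand is non-negative, so the left side is at least `μ` for `μ/d ≥ 0`; in particular a
gap constant satisfies `2∫₀^{μ/d}(…)² = 1 − μ > 0`. [cite: ConreyIwaniecSoundararajan2012SmallGaps, Theorem 2.1 (definition of μ_d)] -/
theorem le_gapFunction {d μ : ℝ} (h : 0 ≤ μ / d) : μ ≤ gapFunction d μ := by
  unfold gapFunction
  have : 0 ≤ ∫ v in (0 : ℝ)..(μ / d), sineKernel v ^ 2 :=
    intervalIntegral.integral_nonneg h fun v _ => sq_nonneg _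
  linarith

/-- A gap constant is a number in `(0, 1)`. [cite: ConreyIwaniecSoundararajan2012SmallGaps, Theorem 2.1 ("0 < μ_d < 1")] -/
theorem IsGapConstant.pos_lt_one {d μ : ℝ} (h : IsGapConstant d μ) : 0 < μ ∧ μ < 1 :=
  ⟨h.1, h.2.1⟩

end ConreyIwaniecSoundararajan2012

open ConreyIwaniecSoundararajan2012

/-- **Conrey–Iwaniec–Soundararajan 2012, Theorem 2.1, degree `d = 1`** (`L_f = ζ`, `N = 1`, twists
= Dirichlet `L`-functions): "Assume the Riemann Hypothesis for `L_f(s,χ)` for all primitive `χ` …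
Then, for any `ε > 0` and for all sufficiently large `Q`, there is a `q` with `Q ≤ q ≤ 2Q` and a
primitive `χ mod q` and a pair of zeros `½ + iγ` and `½ + iγ′` of `L_f(s,χ)` such that
`|γ|, |γ′| ≤ 1` and `|γ − γ′| < (μ_d + ε)·2π/(d log Q)`", `μ₁ ≈ 0.366`. Rendered: under the tree's
`GeneralizedRiemannHypothesis`, for every solution `μ ∈ (0,1)` of the `d = 1` equation and every
`ε > 0` there is `Q₀` such that for all `Q ≥ Q₀` some primitive `χ` mod some `q ∈ [Q, 2Q]` has
critical zeros at ordinates `γ, γ′ ∈ [−1, 1]`, distinct or a multiple zero, with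
`|γ − γ′| < (μ + ε)·2π/log Q`. NAMED FACT, not proved here (asymptotic large sieve, §§5–8 of the
source). On GRH only — by the authors' own analysis void for class numbers / Siegel zeros.
[cite: ConreyIwaniecSoundararajan2012SmallGaps, Theorem 2.1 (case d = 1)] -/
def conreyIwaniecSoundararajan2012_theorem21_degreeOne : Prop :=
  GeneralizedRiemannHypothesis →
    ∀ μ : ℝ, IsGapConstant 1 μ → ∀ ε : ℝ, 0 < ε →
      ∃ Q₀ : ℝ, ∀ Q : ℝ, Q₀ ≤ Q →
        ∃ (q : ℕ) (_ : NeZero q), (Q ≤ (q : ℝ) ∧ (q : ℝ) ≤ 2 * Q) ∧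
          ∃ χ : DirichletCharacter ℂ q, χ.IsPrimitive ∧
            ∃ γ γ' : ℝ, |γ| ≤ 1 ∧ |γ'| ≤ 1 ∧
              χ.LFunction (1 / 2 + γ * I) = 0 ∧ χ.LFunction (1 / 2 + γ' * I) = 0 ∧
              (γ ≠ γ' ∨ deriv χ.LFunction (1 / 2 + γ * I) = 0) ∧
              |γ - γ'| < (μ + ε) * (2 * π / Real.log Q)
-- TODO(general form): degree-`d` primitive automorphic `L_f` of level `N`, twists by primitive `χ`
-- of modulus coprime to `N`, mean spacing `2π/(d log Q)`, constant `μ_d` (`IsGapConstant d`).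

/-! ### Bookkeeping (proved) -/

/-- **The printed rephrasing** "there are a pair of zeros that are closer together than `μ_d` [+ε]
times the average spacing": modulo the fact, on GRH, for every gap constant `μ` (`≈ 0.366 < ½`)
and every `ε > 0`, eventually in `Q` some Dirichlet `L`-function of conductor in `[Q, 2Q]` has two
low-lying critical zeros (or a multiple one) within `(μ + ε)` mean spacings `2π/log Q` — the
normalised form used in the harvest row. PROVED (restatement with the spacing divided out).
[cite: ConreyIwaniecSoundararajan2012SmallGaps, Theorem 2.1 and the sentence after it] -/
theorem exists_pair_within_normalised (h : conreyIwaniecSoundararajan2012_theorem21_degreeOne)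
    (hGRH : GeneralizedRiemannHypothesis) {μ : ℝ} (hμ : IsGapConstant 1 μ) {ε : ℝ} (hε : 0 < ε) :
    ∃ Q₀ : ℝ, ∀ Q : ℝ, Q₀ ≤ Q → 1 < Q →
      ∃ (q : ℕ) (_ : NeZero q), (Q ≤ (q : ℝ) ∧ (q : ℝ) ≤ 2 * Q) ∧
        ∃ χ : DirichletCharacter ℂ q, χ.IsPrimitive ∧
          ∃ γ γ' : ℝ, |γ| ≤ 1 ∧ |γ'| ≤ 1 ∧
            χ.LFunction (1 / 2 + γ * I) = 0 ∧ χ.LFunction (1 / 2 + γ' * I) = 0 ∧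
            (γ ≠ γ' ∨ deriv χ.LFunction (1 / 2 + γ * I) = 0) ∧
            |γ - γ'| / (2 * π / Real.log Q) < μ + ε := by
  obtain ⟨Q₀, hQ₀⟩ := h hGRH μ hμ ε hε
  refine ⟨Q₀, fun Q hQ hQ1 => ?_⟩
  obtain ⟨q, hq, hqQ, χ, hχ, γ, γ', hγ, hγ', hz, hz', hne, hgap⟩ := hQ₀ Q hQ
  refine ⟨q, hq, hqQ, χ, hχ, γ, γ', hγ, hγ', hz, hz', hne, ?_⟩
  have hsp : 0 < 2 * π / Real.log Q := by
    have := Real.log_pos hQ1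
    positivity
  rwa [div_lt_iff₀ hsp]

end Literature.NumberTheory.LFunctions

end
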